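import Summits.Ventures.CertifiedManyBodySolver.Certificates.HubbardSquare_transportClosure_Kit
import HarnessLib

/-!
# Ventures/CertifiedManyBodySolver — Certificates/HubbardSquare_transportClosure_KitE.lean
# (hubbard-fast-reuse-5 g5, cell hubbard-fast, D-0154 (A) CERTIFICATE REUSE: the TRANSPORT-CLOSURE kit, part 8 = EVEN HALF-FILLING
# transport; parts 1/2 = hubbard-fast-reuse-1's `…_Kit.lean` / `…_KitLaws.lean`, 3 = `…_KitT`, 4/5 = `…_KitN` / `…_KitN2`,
# 6 = `…_KitS`, 7 = `…_KitF` / `…_KitF2`)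

At HALF FILLING the ground-state energy density is EVEN in the diagonal hopping, `e₀(t, -s, U, 1) = e₀(t, s, U, 1)`
(`energyDensityTT'_particleHole_one`, the `n = 1` case of the particle–hole map [Lieb–Wu 2003, §1 eq. (3)]), and it is CONCAVE in
`s` at fixed `U ≥ 0` (`energyDensityTT'_ge_convexComb` with `U₁ = U₂`, [Israel 1979, Thm. I.3.4]). An even concave function of one
variable is NON-INCREASING in the absolute value: `|σ| ≤ |s| ⇒ e₀(t, s, U, 1) ≤ e₀(t, σ, U, 1)` (§0). Read as transport laws for
the cell's `n = 1` slice words (bilinear in `(U, s)`, the `tc_sliceN_cap` / `tc_sliceN_floor` shape of part 1):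
* `tc_sliceN1_cap_evenOut_neg` / `_pos` — a slice CAP at `n = 1` on hoppings `[σ₁, σ₂] ∋ σ` is, read at the column `σ`, a cap at
  `n = 1` on EVERY hopping range `[s₁, s₂]` lying outside `(-|σ|, |σ|)` on the negative (`s₂ ≤ σ`, `s₂ ≤ -σ`) resp. positive
  (`σ ≤ s₁`, `-σ ≤ s₁`) side: caps move OUTWARD in `|t'|`, loss-free; the output is affine in `U` and constant in `s`;
* `tc_sliceN1_floor_evenIn_neg` / `_pos` — a slice FLOOR at `n = 1` on `[σ₁, σ₂] ∋ σ` (`σ ≤ 0` resp. `0 ≤ σ`) is a floor at `n = 1`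
  on every `[s₁, s₂] ⊆ [-|σ|, |σ|]`: floors move INWARD.
The outputs are `n = 1` slice words in exactly the hypothesis shape of `KitLaws.tc_mlCap_nchord` (caps between two densities) and
`KitN2.tc_mlFloor_nsecxL` / `tc_mlFloor_nsecxR` (outward density-secant floors), which carry them to cells of positive `n`-width.
Use: the `n ≈ 1` boxes at large `|t'|` (YBa₂Cu₃O₆ / Nd₂CuO₄ parents, Ca₂CuO₂Cl₂, La₂CuO₄) inherit every cap certified nearer
`t' = 0` at half filling, and every floor certified farther out.
HONEST FRAMING: bookkeeping adapters; they certify nothing by themselves; every consumer word inherits exactly the hypotheses of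
the words it cites; no number of record; not a phase word; no summit statement is proved here; not a superconductivity verdict.
-/

namespace Summit.Ventures.CertifiedManyBodySolver.Certificates

open Literature.MathematicalPhysics.QuantumLattice
open Literature.MathematicalPhysics.QuantumLattice.ThermodynamicLimit
open Set

/-! ### §0 The law: at half filling `e₀` is non-increasing in `|t'|` -/

/-- **Even + concave ⇒ non-increasing in the absolute value.** At half filling (`n = 1`) and `U ≥ 0`,
`|σ| ≤ |s|` implies `e₀(t, s, U, 1) ≤ e₀(t, σ, U, 1)`: write `σ = a·s + b·(-s)` with `a = (1 + σ/s)/2`, `b = (1 - σ/s)/2 ∈ [0, 1]`,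
apply joint concavity on the segment from `(s, U)` to `(-s, U)` and the evenness `e₀(t, -s, U, 1) = e₀(t, s, U, 1)`.
[cite: LiebWuPhysicaA2003, §1 eq. (3)] [cite: Israel1979, Thm. I.3.4] -/
theorem energyDensityTT'_halfFilling_le_of_abs_le (t : ℝ) {U σ s : ℝ} (hU : 0 ≤ U) (h : |σ| ≤ |s|) :
    energyDensityTT' t s U 1 ≤ energyDensityTT' t σ U 1 := by
  rcases eq_or_ne s 0 with hs | hs
  · have hσ : σ = 0 := by
      rw [hs, abs_zero] at h
      exact abs_eq_zero.1 (le_antisymm h (abs_nonneg σ))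
    rw [hs, hσ]
  · have hs' : 0 < |s| := abs_pos.2 hs
    have hq : |σ / s| ≤ 1 := by
      rw [abs_div]
      exact (div_le_one hs').2 h
    have hq1 : σ / s ≤ 1 := (le_abs_self _).trans hq
    have hq2 : -1 ≤ σ / s := by
      have := neg_abs_le (σ / s)
      linarith
    set a : ℝ := (1 + σ / s) / 2 with ha_def
    set b : ℝ := (1 - σ / s) / 2 with hb_def
    have ha : 0 ≤ a := by rw [ha_def]; linarith
    have hb : 0 ≤ b := by rw [hb_def]; linarith
    have hab : a + b = 1 := by rw [ha_def, hb_def]; ring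
    have heven : energyDensityTT' t (-s) U 1 = energyDensityTT' t s U 1 :=
      energyDensityTT'_particleHole_one t s hU
    have hcc := energyDensityTT'_ge_convexComb t (n := 1) zero_le_one one_lt_two hU hU ha hb hab
      (le_refl (energyDensityTT' t s U 1)) (le_refl (energyDensityTT' t (-s) U 1))
    have es : a * s + b * -s = σ := by
      rw [ha_def, hb_def]; field_simp; ring
    have eU : a * U + b * U = U := by
      calc a * U + b * U = (a + b) * U := by ring
        _ = U := by rw [hab, one_mul]
    rw [es, eU, heven] at hcc
    calc energyDensityTT' t s U 1 = (a + b) * energyDensityTT' t s U 1 := by rw [hab, one_mul]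
      _ = a * energyDensityTT' t s U 1 + b * energyDensityTT' t s U 1 := by ring
      _ ≤ energyDensityTT' t σ U 1 := hcc

/-- The same law read for floors: `|s| ≤ |σ|` and a floor `F ≤ e₀(t, σ, U, 1)` give `F ≤ e₀(t, s, U, 1)`.
[cite: LiebWuPhysicaA2003, §1 eq. (3)] -/
theorem energyDensityTT'_halfFilling_ge_of_abs_le (t : ℝ) {U σ s F : ℝ} (hU : 0 ≤ U) (h : |s| ≤ |σ|)
    (hF : F ≤ energyDensityTT' t σ U 1) : F ≤ energyDensityTT' t s U 1 :=
  hF.trans (energyDensityTT'_halfFilling_le_of_abs_le t hU h)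

/-! ### §1 Caps move outward in `|t'|` (slice shape of `tc_mlCap_nchord`) -/

/-- **EVEN-OUT CAP, negative side.** A bilinear cap `e₀(t, s', U, 1) ≤ α₀ + α₁U + α₂s' + α₃Us'` on `U ∈ [Ua, Ub]` (`Ua ≥ 0`),
`s' ∈ [σ₁, σ₂]`, read at a column `σ ∈ [σ₁, σ₂]`, caps `e₀(t, s, U, 1)` for every `s ∈ [s₁, s₂]` with `s₂ ≤ σ` and `s₂ ≤ -σ`
(so `|s| ≥ |σ|`): the output `(α₀ + α₂σ) + (α₁ + α₃σ)U` is an `n = 1` slice cap on `[Ua, Ub] × [s₁, s₂]`.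
[cite: LiebWuPhysicaA2003, §1 eq. (3)] -/
theorem tc_sliceN1_cap_evenOut_neg (t : ℝ) {Ua Ub σ₁ σ₂ σ s₁ s₂ α₀ α₁ α₂ α₃ : ℝ}
    (hUa : 0 ≤ Ua) (hσ₁ : σ₁ ≤ σ) (hσ₂ : σ ≤ σ₂) (h₂ : s₂ ≤ σ) (h₂' : s₂ ≤ -σ)
    (hA : ∀ U s' : ℝ, Ua ≤ U → U ≤ Ub → σ₁ ≤ s' → s' ≤ σ₂ →
      energyDensityTT' t s' U 1 ≤ α₀ + α₁ * U + α₂ * s' + α₃ * U * s') :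
    ∀ U s : ℝ, Ua ≤ U → U ≤ Ub → s₁ ≤ s → s ≤ s₂ →
      energyDensityTT' t s U 1 ≤ (α₀ + α₂ * σ) + (α₁ + α₃ * σ) * U + 0 * s + 0 * U * s := by
  intro U s k1 k2 _ k4
  have hU : 0 ≤ U := hUa.trans k1
  have habs : |σ| ≤ |s| := by
    have hs : s ≤ 0 := by
      rcases le_or_gt σ 0 with hσ | hσ
      · exact k4.trans (h₂.trans hσ)
      · exact k4.trans (h₂'.trans (by linarith))
    rw [abs_of_nonpos hs]
    exact abs_le.2 ⟨by linarith, by linarith⟩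
  have h1 := energyDensityTT'_halfFilling_le_of_abs_le t hU habs
  have h2 := hA U σ k1 k2 hσ₁ hσ₂
  linear_combination h1 + h2

/-- **EVEN-OUT CAP, positive side**: as `tc_sliceN1_cap_evenOut_neg` for target hoppings `s ∈ [s₁, s₂]` with `σ ≤ s₁` and
`-σ ≤ s₁`. [cite: LiebWuPhysicaA2003, §1 eq. (3)] -/
theorem tc_sliceN1_cap_evenOut_pos (t : ℝ) {Ua Ub σ₁ σ₂ σ s₁ s₂ α₀ α₁ α₂ α₃ : ℝ}
    (hUa : 0 ≤ Ua) (hσ₁ : σ₁ ≤ σ) (hσ₂ : σ ≤ σ₂) (h₁ : σ ≤ s₁) (h₁' : -σ ≤ s₁)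
    (hA : ∀ U s' : ℝ, Ua ≤ U → U ≤ Ub → σ₁ ≤ s' → s' ≤ σ₂ →
      energyDensityTT' t s' U 1 ≤ α₀ + α₁ * U + α₂ * s' + α₃ * U * s') :
    ∀ U s : ℝ, Ua ≤ U → U ≤ Ub → s₁ ≤ s → s ≤ s₂ →
      energyDensityTT' t s U 1 ≤ (α₀ + α₂ * σ) + (α₁ + α₃ * σ) * U + 0 * s + 0 * U * s := by
  intro U s k1 k2 k3 _
  have hU : 0 ≤ U := hUa.trans k1
  have habs : |σ| ≤ |s| := by
    have hs : 0 ≤ s := by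
      rcases le_or_gt 0 σ with hσ | hσ
      · exact hσ.trans (h₁.trans k3)
      · exact (le_of_lt (by linarith : (0:ℝ) < -σ)).trans (h₁'.trans k3)
    rw [abs_of_nonneg hs]
    exact abs_le.2 ⟨by linarith, by linarith⟩
  have h1 := energyDensityTT'_halfFilling_le_of_abs_le t hU habs
  have h2 := hA U σ k1 k2 hσ₁ hσ₂
  linear_combination h1 + h2

/-! ### §2 Floors move inward in `|t'|` (slice shape of `tc_mlFloor_nsecxL` / `tc_mlFloor_nsecxR`) -/

/-- **EVEN-IN FLOOR, from a non-positive column.** A bilinear floor `α₀ + α₁U + α₂s' + α₃Us' ≤ e₀(t, s', U, 1)` on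
`U ∈ [Ua, Ub]` (`Ua ≥ 0`), `s' ∈ [σ₁, σ₂]`, read at a column `σ ∈ [σ₁, σ₂]` with `σ ≤ 0`, floors `e₀(t, s, U, 1)` for every
`s ∈ [s₁, s₂] ⊆ [σ, -σ]` (so `|s| ≤ |σ|`). [cite: LiebWuPhysicaA2003, §1 eq. (3)] -/
theorem tc_sliceN1_floor_evenIn_neg (t : ℝ) {Ua Ub σ₁ σ₂ σ s₁ s₂ α₀ α₁ α₂ α₃ : ℝ}
    (hUa : 0 ≤ Ua) (hσ₁ : σ₁ ≤ σ) (hσ₂ : σ ≤ σ₂) (hσ : σ ≤ 0) (h₁ : σ ≤ s₁) (h₂ : s₂ ≤ -σ)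
    (hA : ∀ U s' : ℝ, Ua ≤ U → U ≤ Ub → σ₁ ≤ s' → s' ≤ σ₂ →
      α₀ + α₁ * U + α₂ * s' + α₃ * U * s' ≤ energyDensityTT' t s' U 1) :
    ∀ U s : ℝ, Ua ≤ U → U ≤ Ub → s₁ ≤ s → s ≤ s₂ →
      (α₀ + α₂ * σ) + (α₁ + α₃ * σ) * U + 0 * s + 0 * U * s ≤ energyDensityTT' t s U 1 := by
  intro U s k1 k2 k3 k4
  have hU : 0 ≤ U := hUa.trans k1
  have habs : |s| ≤ |σ| := by
    rw [abs_of_nonpos hσ]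
    exact abs_le.2 ⟨by linarith, by linarith⟩
  have h2 := hA U σ k1 k2 hσ₁ hσ₂
  have h1 := energyDensityTT'_halfFilling_ge_of_abs_le t hU habs h2
  linear_combination h1

/-- **EVEN-IN FLOOR, from a non-negative column**: as `tc_sliceN1_floor_evenIn_neg` with `0 ≤ σ` and target
`[s₁, s₂] ⊆ [-σ, σ]`. [cite: LiebWuPhysicaA2003, §1 eq. (3)] -/
theorem tc_sliceN1_floor_evenIn_pos (t : ℝ) {Ua Ub σ₁ σ₂ σ s₁ s₂ α₀ α₁ α₂ α₃ : ℝ}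
    (hUa : 0 ≤ Ua) (hσ₁ : σ₁ ≤ σ) (hσ₂ : σ ≤ σ₂) (hσ : 0 ≤ σ) (h₁ : -σ ≤ s₁) (h₂ : s₂ ≤ σ)
    (hA : ∀ U s' : ℝ, Ua ≤ U → U ≤ Ub → σ₁ ≤ s' → s' ≤ σ₂ →
      α₀ + α₁ * U + α₂ * s' + α₃ * U * s' ≤ energyDensityTT' t s' U 1) :
    ∀ U s : ℝ, Ua ≤ U → U ≤ Ub → s₁ ≤ s → s ≤ s₂ →
      (α₀ + α₂ * σ) + (α₁ + α₃ * σ) * U + 0 * s + 0 * U * s ≤ energyDensityTT' t s U 1 := by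
  intro U s k1 k2 k3 k4
  have hU : 0 ≤ U := hUa.trans k1
  have habs : |s| ≤ |σ| := by
    rw [abs_of_nonneg hσ]
    exact abs_le.2 ⟨by linarith, by linarith⟩
  have h2 := hA U σ k1 k2 hσ₁ hσ₂
  have h1 := energyDensityTT'_halfFilling_ge_of_abs_le t hU habs h2
  linear_combination h1

/-! ### §3 Producer ROWS as `n = 1` slice inputs (sheet at one anchor ⇒ `n = 1` slice floor on a `U`-range) -/

/-- **SHEET ⇒ `n = 1` slice floor** (the row-fold entry point of the even law). A `μ`-floor `(c, μ)` at ONE anchor `(s₀, U₀)`,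
`U₀ ≥ 0` — a producer row cited BY VALUE, `c + μ·m ≤ e₀(t, s₀, U₀, m)` for every `0 ≤ m < 2` — gives at `m = 1`, carried UP in `U`
(`energyDensityTT'_mono_U`), the `n = 1` slice floor `(c + μ) + 0·U + 0·s' + 0·U·s' ≤ e₀(t, s', U, 1)` on `U ∈ [Ua, Ub]`, `Ua ≥ U₀`,
`s' ∈ [s₀, s₀]` (the column itself) — exactly the `hA` shape of `tc_sliceN1_floor_evenIn_neg/_pos` with `σ₁ = σ₂ = σ = s₀`, so ONE row at
`(s₀, U₀, ·)` floors the whole strip `|t'| ≤ |s₀|`, `U ≥ U₀` at half filling, and then the `n ≠ 1` cells through `tc_mlFloor_nsecxL/R` /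
`tc_mlFloor_nVacuumSecx`. [cite: Ruelle1969, §3.3] -/
theorem tc_sheetN1_floor (t : ℝ) {s₀ U₀ c μ Ua Ub : ℝ}
    (hc : ∀ m : ℝ, 0 ≤ m → m < 2 → c + μ * m ≤ energyDensityTT' t s₀ U₀ m)
    (hU₀ : 0 ≤ U₀) (hUa : U₀ ≤ Ua) :
    ∀ U s' : ℝ, Ua ≤ U → U ≤ Ub → s₀ ≤ s' → s' ≤ s₀ →
      (c + μ) + 0 * U + 0 * s' + 0 * U * s' ≤ energyDensityTT' t s' U 1 := by
  intro U s' k1 _ k3 k4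
  have hs : s' = s₀ := le_antisymm k4 k3
  have h1 := hc 1 zero_le_one one_lt_two
  have h2 := energyDensityTT'_mono_U t s₀ (n := 1) zero_le_one one_lt_two hU₀ (hUa.trans k1)
  rw [hs]
  linarith

/-- **SHEET at the MIRROR hopping ⇒ `n = 1` slice floor.** At half filling the sheet's `m = 1` value is also a floor at the mirror
column `-s₀` (`energyDensityTT'_particleHole_one`): `(c + μ) ≤ e₀(t, s', U, 1)` on `U ≥ Ua ≥ U₀`, `s' ∈ [s₁, s₁]` with `s₀ + s₁ = 0`
(stated additively so that a literal `s₁` unifies). [cite: LiebWuPhysicaA2003, §1 eq. (3)] -/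
theorem tc_sheetN1_floor_mirror (t : ℝ) {s₀ s₁ U₀ c μ Ua Ub : ℝ}
    (hc : ∀ m : ℝ, 0 ≤ m → m < 2 → c + μ * m ≤ energyDensityTT' t s₀ U₀ m)
    (hU₀ : 0 ≤ U₀) (hUa : U₀ ≤ Ua) (hmir : s₀ + s₁ = 0) :
    ∀ U s' : ℝ, Ua ≤ U → U ≤ Ub → s₁ ≤ s' → s' ≤ s₁ →
      (c + μ) + 0 * U + 0 * s' + 0 * U * s' ≤ energyDensityTT' t s' U 1 := by
  intro U s' k1 _ k3 k4
  have hs : s' = -s₀ := by have := le_antisymm k4 k3; linarith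
  have hU : 0 ≤ U := hU₀.trans (hUa.trans k1)
  have h1 := hc 1 zero_le_one one_lt_two
  have h2 := energyDensityTT'_mono_U t s₀ (n := 1) zero_le_one one_lt_two hU₀ (hUa.trans k1)
  have h3 := energyDensityTT'_particleHole_one t s₀ hU
  rw [hs, h3]
  linarith

/-! ### §3b Producer rows as POINT floors at `n = 1` (value only, no tangent) -/

/-- **POINT ⇒ `n = 1` slice floor.** A certified VALUE at one point, `F ≤ e₀(t, s₀, U₀, 1)` (`U₀ ≥ 0`; a producer row at
half filling cited BY VALUE before its density tangent is harvested), carried UP in `U` (`energyDensityTT'_mono_U`), is the `n = 1`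
slice floor `F + 0·U + 0·s' + 0·U·s' ≤ e₀(t, s', U, 1)` on `U ∈ [Ua, Ub]`, `Ua ≥ U₀`, `s' ∈ [s₀, s₀]` — the `hA` shape of
`tc_sliceN1_floor_evenIn_neg/_pos` with `σ = s₀`, so ONE half-filling value floors the strip `|t'| ≤ |s₀|`, `U ≥ U₀` at `n = 1`.
[cite: Ruelle1969, §3.3] -/
theorem tc_pointN1_floor (t : ℝ) {s₀ U₀ F Ua Ub : ℝ}
    (h : F ≤ energyDensityTT' t s₀ U₀ 1) (hU₀ : 0 ≤ U₀) (hUa : U₀ ≤ Ua) :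
    ∀ U s' : ℝ, Ua ≤ U → U ≤ Ub → s₀ ≤ s' → s' ≤ s₀ →
      F + 0 * U + 0 * s' + 0 * U * s' ≤ energyDensityTT' t s' U 1 := by
  intro U s' k1 _ k3 k4
  have hs : s' = s₀ := le_antisymm k4 k3
  have h2 := energyDensityTT'_mono_U t s₀ (n := 1) zero_le_one one_lt_two hU₀ (hUa.trans k1)
  rw [hs]
  linarith

end Summit.Ventures.CertifiedManyBodySolver.Certificates
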